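import Summits.CriticalPhenomena.PercolationContinuityZ3.Theorems.PercNearOneGluingNoHeavyLowerTailStarSetForestComonotone
import Summits.CriticalPhenomena.PercolationContinuityZ3.Theorems.PercNearOneGluingNoHeavyLowerTailStarSetTriangleCertificateCore2
import HarnessLib

/-!
# `NoHeavyLowerTail` (stmt-CriticalPhenomena-4575) — pointwise facts for the TRIANGLE certificate (level `j ≤ 2`)

Support file (prover `prim-gen-swap` gen 9; `--supports stmt-CriticalPhenomena-4575`).  No definitions, no named facts, no sorries.

Three two-port stars on a TRIANGLE of relays `q 0, q 1, q 2`: star `i : Fin 3` has the ports `p i = q (i+1)`, `p' i = q (i+2)` (it is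
opposite to the port `q i`).  For a fixed configuration `ω` (in the application: the configuration off the stars) and the links
`L_σ = {p k p' k : k ∈ σ}`, this file supplies the event inclusions that instantiate the algebraic core `StarSet.triangleCertificate_core₂`
(seat memo TRIANGLE-PROOF.md §4):

* `StarSet.triangle_link_harmless` — if both stars at the port `q d` are lonely-capable, the link of the opposite star `d` leaves `q d` light;
* `StarSet.triangle_third_lonely` — two lonely-capable stars (separated from `c`) force the third;
* `StarSet.triangle_c_trichotomy` — for `c ∈ A` off the ports: either `c` is heavy under every link pattern, or `c` is light under every
  link pattern and separated from the ports, or `c` is glued to exactly one port `q r` (light exactly under the patterns `σ ⊆ {r}`, sharing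
  its cluster with `q r`, and meeting a port of every star `i ≠ r`).
-/

noncomputable section

namespace Summit.CriticalPhenomena.PercolationContinuityZ3.Theorems

open MeasureTheory Set Literature.Probability.LatticeModels Literature.Probability.Percolation
open scoped Classical BigOperators

variable {n : ℕ}

namespace StarSet

/-- Index arithmetic on `Fin 3` used for the triangle. [folklore] -/
theorem fin3_ne_iff (i d : Fin 3) : d ≠ i ↔ (d = i + 1 ∨ d = i + 2) := by
  revert i d; decide

/-- Index arithmetic on `Fin 3` used for the triangle. [folklore] -/
theorem fin3_facts (i : Fin 3) :
    i + 1 ≠ i ∧ i + 2 ≠ i ∧ i + 1 ≠ i + 2 ∧ i + 1 + 1 = i + 2 ∧ i + 1 + 2 = i ∧ i + 2 + 1 = i ∧ i + 2 + 2 = i + 1 := by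
  revert i; decide

/-- No two stars of the triangle have the same pair of ports (index form). [folklore] -/
theorem fin3_nopar (i k : Fin 3) (hik : i ≠ k) : ¬ ((k + 1 = i + 1 ∨ k + 1 = i + 2) ∧ (k + 2 = i + 1 ∨ k + 2 = i + 2)) := by
  revert i k; decide

/-- **Both stars at a port lonely-capable ⇒ the opposite link is harmless.**  If the stars `d+1` and `d+2` (the two stars having `q d`
as a port) both see at most `j ≤ 2` relays from their ports, then `q d` sees at most `j` relays in `ω ∪ {p d p' d}`. [folklore] -/
theorem triangle_link_harmless (ω : BondConfig (Fin n)) (A : Finset (Fin n)) (p p' q : Fin 3 → Fin n)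
    (hp : ∀ i, p i = q (i + 1)) (hp' : ∀ i, p' i = q (i + 2)) (j : ℕ) (hj : j ≤ 2)
    (hqA : ∀ d, q d ∈ A) (hq : Function.Injective q) (d : Fin 3)
    (hl1 : (A.filter fun z => ∃ u ∈ ({d + 1} : Finset (Fin 3)).image p ∪ ({d + 1} : Finset (Fin 3)).image p',
      (openGraph ω).Reachable u z).card ≤ j)
    (hl2 : (A.filter fun z => ∃ u ∈ ({d + 2} : Finset (Fin 3)).image p ∪ ({d + 2} : Finset (Fin 3)).image p',
      (openGraph ω).Reachable u z).card ≤ j) :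
    (A.filter fun z => (openGraph (ω ∪ ↑(({d} : Finset (Fin 3)).image fun k => (s(p k, p' k) : Sym2 (Fin n))))).Reachable
      (q d) z).card ≤ j := by
  have hpA : ∀ i, p i ∈ A := fun i => (hp i) ▸ hqA (i + 1)
  have hp'A : ∀ i, p' i ∈ A := fun i => (hp' i) ▸ hqA (i + 2)
  have hpp' : ∀ i, p i ≠ p' i := by
    intro i h
    rw [hp i, hp' i] at h
    exact (fin3_facts i).2.2.1 (hq h)
  have hp2 : p (d + 2) = q d := by rw [hp, (fin3_facts d).2.2.2.2.2.1]
  have hp'2 : p' (d + 2) = q (d + 1) := by rw [hp', (fin3_facts d).2.2.2.2.2.2]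
  have hp1 : p (d + 1) = q (d + 2) := by rw [hp, (fin3_facts d).2.2.2.1]
  have hp'1 : p' (d + 1) = q d := by rw [hp', (fin3_facts d).2.2.2.2.1]
  by_cases hA : (openGraph ω).Reachable (p (d + 2)) (p' (d + 2))
  · -- type B at star `d+2` (`q d ↔ q (d+1)`) makes star `d+1` see three relays: impossible
    exfalso
    obtain ⟨hrel1, -⟩ := lonely_pair_relays ω A p p' (d + 1) j hj hpA hp'A hpp' ((card_filter_congr fun _ _ => Iff.rfl).trans_le hl1)
    have hreach : (openGraph ω).Reachable (p' (d + 1)) (q (d + 1)) := by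
      rw [hp'1, ← hp2, ← hp'2]; exact hA
    rcases hrel1 (q (d + 1)) (hqA _) (Or.inr hreach) with h | h
    · rw [hp1] at h; exact (fin3_facts d).2.2.1 (hq h)
    · rw [hp'1] at h; exact (fin3_facts d).1 (hq h)
  · have h := lonely_port_light_closed ω A p p' (d + 2) {d} j hj hpA hp'A hpp' ((card_filter_congr fun _ _ => Iff.rfl).trans_le hl2)
      hA (fun k hk => by
        rw [Finset.mem_singleton.1 hk, hp2, hp d, hp' d]
        exact ⟨fun h => (fin3_facts d).1 (hq h), fun h => (fin3_facts d).2.1 (hq h)⟩)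
    rw [hp2] at h
    exact (card_filter_congr fun _ _ => Iff.rfl).trans_le h

/-- **Two lonely-capable stars force the third.**  If the stars `k+1` and `k+2` are separated from `c` and see at most `j ≤ 2` relays from
their ports, then so does the star `k`. [folklore] -/
theorem triangle_third_lonely (ω : BondConfig (Fin n)) (A : Finset (Fin n)) (p p' q : Fin 3 → Fin n)
    (hp : ∀ i, p i = q (i + 1)) (hp' : ∀ i, p' i = q (i + 2)) (c : Fin n) (j : ℕ) (hj : j ≤ 2)
    (hqA : ∀ d, q d ∈ A) (hq : Function.Injective q) (k : Fin 3)
    (hsep1 : ∀ u ∈ ({k + 1} : Finset (Fin 3)).image p ∪ ({k + 1} : Finset (Fin 3)).image p', ¬ (openGraph ω).Reachable c u)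
    (hl1 : (A.filter fun z => ∃ u ∈ ({k + 1} : Finset (Fin 3)).image p ∪ ({k + 1} : Finset (Fin 3)).image p',
      (openGraph ω).Reachable u z).card ≤ j)
    (hsep2 : ∀ u ∈ ({k + 2} : Finset (Fin 3)).image p ∪ ({k + 2} : Finset (Fin 3)).image p', ¬ (openGraph ω).Reachable c u)
    (hl2 : (A.filter fun z => ∃ u ∈ ({k + 2} : Finset (Fin 3)).image p ∪ ({k + 2} : Finset (Fin 3)).image p',
      (openGraph ω).Reachable u z).card ≤ j) :
    (∀ u ∈ ({k} : Finset (Fin 3)).image p ∪ ({k} : Finset (Fin 3)).image p', ¬ (openGraph ω).Reachable c u) ∧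
      1 ≤ (A.filter fun z => ∃ u ∈ ({k} : Finset (Fin 3)).image p ∪ ({k} : Finset (Fin 3)).image p',
        (openGraph ω).Reachable u z).card ∧
      (A.filter fun z => ∃ u ∈ ({k} : Finset (Fin 3)).image p ∪ ({k} : Finset (Fin 3)).image p',
        (openGraph ω).Reachable u z).card ≤ j := by
  have hpA : ∀ i, p i ∈ A := fun i => (hp i) ▸ hqA (i + 1)
  have hp'A : ∀ i, p' i ∈ A := fun i => (hp' i) ▸ hqA (i + 2)
  have hpp' : ∀ i, p i ≠ p' i := by
    intro i h
    rw [hp i, hp' i] at h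
    exact (fin3_facts i).2.2.1 (hq h)
  have hp2 : p (k + 2) = q k := by rw [hp, (fin3_facts k).2.2.2.2.2.1]
  have hp'2 : p' (k + 2) = q (k + 1) := by rw [hp', (fin3_facts k).2.2.2.2.2.2]
  have hp1 : p (k + 1) = q (k + 2) := by rw [hp, (fin3_facts k).2.2.2.1]
  have hp'1 : p' (k + 1) = q k := by rw [hp', (fin3_facts k).2.2.2.2.1]
  obtain ⟨hrel1, hj2⟩ := lonely_pair_relays ω A p p' (k + 1) j hj hpA hp'A hpp' ((card_filter_congr fun _ _ => Iff.rfl).trans_le hl1)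
  obtain ⟨hrel2, -⟩ := lonely_pair_relays ω A p p' (k + 2) j hj hpA hp'A hpp' ((card_filter_congr fun _ _ => Iff.rfl).trans_le hl2)
  simp only [Finset.image_singleton, Finset.mem_union, Finset.mem_singleton] at hsep1 hsep2 ⊢
  refine ⟨?_, ?_, ?_⟩
  · rintro u (rfl | rfl)
    · have : p k = p' (k + 2) := by rw [hp k, hp'2]
      rw [this]
      exact hsep2 _ (Or.inr rfl)
    · have : p' k = p (k + 1) := by rw [hp' k, hp1]
      rw [this]
      exact hsep1 _ (Or.inl rfl)
  · exact Finset.card_pos.2 ⟨p k, Finset.mem_filter.2 ⟨hpA k, p k, Or.inl rfl, SimpleGraph.Reachable.refl _⟩⟩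
  · rw [hj2]
    have hsub : (A.filter fun z => ∃ u, (u = p k ∨ u = p' k) ∧ (openGraph ω).Reachable u z) ⊆ {p k, p' k} := by
      intro z hz
      rw [Finset.mem_filter] at hz
      obtain ⟨hzA, u, hu, huz⟩ := hz
      simp only [Finset.mem_insert, Finset.mem_singleton]
      rcases hu with rfl | rfl
      · have huz' : (openGraph ω).Reachable (p' (k + 2)) z := by rw [hp'2, ← hp k]; exact huz
        rcases hrel2 z hzA (Or.inr huz') with h | h
        · exfalso
          have hr : (openGraph ω).Reachable (p' (k + 1)) (p k) := by
            rw [hp'1, ← hp2, ← h]; exact huz.symm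
          rcases hrel1 (p k) (hpA k) (Or.inr hr) with h' | h'
          · rw [hp k, hp1] at h'; exact (fin3_facts k).2.2.1 (hq h')
          · rw [hp k, hp'1] at h'; exact (fin3_facts k).1 (hq h')
        · left; rw [hp k, ← hp'2, h]
      · have huz' : (openGraph ω).Reachable (p (k + 1)) z := by rw [hp1, ← hp' k]; exact huz
        rcases hrel1 z hzA (Or.inl huz') with h | h
        · right; rw [hp' k, ← hp1, h]
        · exfalso
          have hr : (openGraph ω).Reachable (p (k + 2)) (p' k) := by
            rw [hp2, ← hp'1, ← h]; exact huz.symm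
          rcases hrel2 (p' k) (hp'A k) (Or.inl hr) with h' | h'
          · rw [hp' k, hp2] at h'; exact (fin3_facts k).2.1 (hq h')
          · rw [hp' k, hp'2] at h'; exact (fin3_facts k).2.2.1 (hq h').symm
    calc (A.filter fun z => ∃ u, (u = p k ∨ u = p' k) ∧ (openGraph ω).Reachable u z).card
        ≤ ({p k, p' k} : Finset (Fin n)).card := Finset.card_le_card hsub
      _ ≤ 2 := Finset.card_le_two

/-- **Trichotomy for `c`.**  For `c ∈ A` off the three ports and `j ≤ 2`, with links `L_σ = {p k p' k : k ∈ σ}`: either (i) `c` sees more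
than `j` relays under every link pattern; or (ii) `c` sees at most `j` relays under every pattern and is separated from the three ports;
or (iii) there is a port `q r` joined to `c` such that `c` sees at most `j` relays exactly under the patterns `σ ⊆ {r}`, `q r` sees at most
`j` relays iff `c` does, and every star `i ≠ r` has a port joined to `c`. [folklore] -/
theorem triangle_c_trichotomy (ω : BondConfig (Fin n)) (A : Finset (Fin n)) (p p' q : Fin 3 → Fin n)
    (hp : ∀ i, p i = q (i + 1)) (hp' : ∀ i, p' i = q (i + 2)) (c : Fin n) (j : ℕ) (hj : j ≤ 2)
    (hqA : ∀ d, q d ∈ A) (hq : Function.Injective q) (hcA : c ∈ A) (hcq : ∀ d, c ≠ q d) :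
    (∀ σ : Finset (Fin 3), j < (A.filter fun z =>
        (openGraph (ω ∪ ↑(σ.image fun k => (s(p k, p' k) : Sym2 (Fin n))))).Reachable c z).card) ∨
    ((∀ σ : Finset (Fin 3), (A.filter fun z =>
        (openGraph (ω ∪ ↑(σ.image fun k => (s(p k, p' k) : Sym2 (Fin n))))).Reachable c z).card ≤ j) ∧
      (∀ d, ¬ (openGraph ω).Reachable c (q d)) ∧ (A.filter fun z => (openGraph ω).Reachable c z).card ≤ j) ∨
    (∃ r, (∀ σ : Finset (Fin 3), (A.filter fun z =>
          (openGraph (ω ∪ ↑(σ.image fun k => (s(p k, p' k) : Sym2 (Fin n))))).Reachable c z).card ≤ j ↔ σ ⊆ {r}) ∧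
        (∀ σ : Finset (Fin 3), (A.filter fun z =>
            (openGraph (ω ∪ ↑(σ.image fun k => (s(p k, p' k) : Sym2 (Fin n))))).Reachable (q r) z).card ≤ j ↔
          (A.filter fun z =>
            (openGraph (ω ∪ ↑(σ.image fun k => (s(p k, p' k) : Sym2 (Fin n))))).Reachable c z).card ≤ j) ∧
        (∀ i, i ≠ r → ∃ u ∈ ({i} : Finset (Fin 3)).image p ∪ ({i} : Finset (Fin 3)).image p', (openGraph ω).Reachable c u)) := by
  have hpA : ∀ i, p i ∈ A := fun i => (hp i) ▸ hqA (i + 1)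
  have hp'A : ∀ i, p' i ∈ A := fun i => (hp' i) ▸ hqA (i + 2)
  have hpp' : ∀ i, p i ≠ p' i := by
    intro i h
    rw [hp i, hp' i] at h
    exact (fin3_facts i).2.2.1 (hq h)
  have hcp : ∀ i, c ≠ p i ∧ c ≠ p' i := fun i => ⟨(hp i) ▸ hcq (i + 1), (hp' i) ▸ hcq (i + 2)⟩
  have hqport : ∀ i d, d ≠ i → q d = p i ∨ q d = p' i := by
    intro i d hdi
    rcases (fin3_ne_iff i d).1 hdi with rfl | rfl
    · exact Or.inl (hp i).symm
    · exact Or.inr (hp' i).symm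
  set L : Finset (Fin 3) → Set (Sym2 (Fin n)) := fun σ => ↑(σ.image fun k => (s(p k, p' k) : Sym2 (Fin n))) with hL
  change (∀ σ : Finset (Fin 3), j < (A.filter fun z => (openGraph (ω ∪ L σ)).Reachable c z).card) ∨
    ((∀ σ : Finset (Fin 3), (A.filter fun z => (openGraph (ω ∪ L σ)).Reachable c z).card ≤ j) ∧
      (∀ d, ¬ (openGraph ω).Reachable c (q d)) ∧ (A.filter fun z => (openGraph ω).Reachable c z).card ≤ j) ∨
    (∃ r, (∀ σ : Finset (Fin 3), (A.filter fun z => (openGraph (ω ∪ L σ)).Reachable c z).card ≤ j ↔ σ ⊆ {r}) ∧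
        (∀ σ : Finset (Fin 3), (A.filter fun z => (openGraph (ω ∪ L σ)).Reachable (q r) z).card ≤ j ↔
          (A.filter fun z => (openGraph (ω ∪ L σ)).Reachable c z).card ≤ j) ∧
        (∀ i, i ≠ r → ∃ u ∈ ({i} : Finset (Fin 3)).image p ∪ ({i} : Finset (Fin 3)).image p', (openGraph ω).Reachable c u))
  have hmemL : ∀ σ e, e ∈ L σ ↔ ∃ i ∈ σ, (s(p i, p' i) : Sym2 (Fin n)) = e := by
    intro σ e
    simp only [hL, Finset.coe_image, Set.mem_image, Finset.mem_coe]
  by_cases hheavy : j < (A.filter fun z => (openGraph ω).Reachable c z).card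
  · -- (i) `c` heavy already without links
    refine Or.inl fun σ => lt_of_lt_of_le hheavy (Finset.card_le_card fun z hz => ?_)
    rw [Finset.mem_filter] at hz ⊢
    exact ⟨hz.1, reachable_mono_union ω (L σ) hz.2⟩
  push Not at hheavy
  by_cases hport : ∃ r, (openGraph ω).Reachable c (q r)
  · -- (iii) `c` glued to exactly one port `q r`
    obtain ⟨r, hr⟩ := hport
    have hfar : ∀ d, d ≠ r → ¬ (openGraph ω).Reachable c (q d) := by
      intro d hdr hd
      have hsub : ({c, q r, q d} : Finset (Fin n)) ⊆ A.filter fun z => (openGraph ω).Reachable c z := by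
        intro z hz
        simp only [Finset.mem_insert, Finset.mem_singleton] at hz
        rw [Finset.mem_filter]
        rcases hz with rfl | rfl | rfl
        · exact ⟨hcA, SimpleGraph.Reachable.refl _⟩
        · exact ⟨hqA r, hr⟩
        · exact ⟨hqA d, hd⟩
      have hcard : ({c, q r, q d} : Finset (Fin n)).card = 3 := by
        rw [Finset.card_insert_of_notMem, Finset.card_pair (fun h => hdr (hq h).symm)]
        simp only [Finset.mem_insert, Finset.mem_singleton, not_or]
        exact ⟨hcq r, hcq d⟩
      have := Finset.card_le_card hsub
      omega
    have hGiff : ∀ σ, (A.filter fun z => (openGraph (ω ∪ L σ)).Reachable c z).card ≤ j ↔ σ ⊆ {r} := by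
      intro σ
      constructor
      · intro hsmall i hi
        rw [Finset.mem_singleton]
        by_contra hir
        have he : (s(p i, p' i) : Sym2 (Fin n)) ∈ L σ := (hmemL σ _).2 ⟨i, hi, rfl⟩
        rcases hqport i r (Ne.symm hir) with hri | hri
        · have h3 := three_le_card_of_reachable_link ω (L σ) A c hcA (hpp' i) (hpA i) (hp'A i) (hcp i).1.symm (hcp i).2.symm he
            (by rw [← hri]; exact reachable_mono_union ω (L σ) hr)
          have := h3.trans ((card_filter_congr fun _ _ => Iff.rfl).trans_le hsmall)
          omega
        · have he' : (s(p' i, p i) : Sym2 (Fin n)) ∈ L σ := by rw [Sym2.eq_swap]; exact he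
          have h3 := three_le_card_of_reachable_link ω (L σ) A c hcA (hpp' i).symm (hp'A i) (hpA i) (hcp i).2.symm (hcp i).1.symm
            he' (by rw [← hri]; exact reachable_mono_union ω (L σ) hr)
          have := h3.trans ((card_filter_congr fun _ _ => Iff.rfl).trans_le hsmall)
          omega
      · intro hσ
        have hfarL : ∀ e ∈ L σ, ∀ v ∈ e, ¬ (openGraph ω).Reachable c v := by
          intro e he v hv
          obtain ⟨i, hi, rfl⟩ := (hmemL σ e).1 he
          have hir : i = r := Finset.mem_singleton.1 (hσ hi)
          rcases Sym2.mem_iff.1 hv with rfl | rfl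
          · rw [hp i, hir]; exact hfar (r + 1) (fin3_facts r).1
          · rw [hp' i, hir]; exact hfar (r + 2) (fin3_facts r).2.1
        have hiff := reachable_union_links_iff ω (L σ) c hfarL
        have hset : (A.filter fun z => (openGraph (ω ∪ L σ)).Reachable c z) = A.filter fun z => (openGraph ω).Reachable c z :=
          Finset.filter_congr fun z _ => hiff z
        rw [hset]; exact hheavy
    refine Or.inr (Or.inr ⟨r, hGiff, fun σ => ?_, fun i hir => ?_⟩)
    · have hr' : (openGraph (ω ∪ L σ)).Reachable c (q r) := reachable_mono_union ω (L σ) hr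
      have hset : (A.filter fun z => (openGraph (ω ∪ L σ)).Reachable (q r) z) = A.filter fun z => (openGraph (ω ∪ L σ)).Reachable c z :=
        Finset.filter_congr fun z _ => ⟨fun h => hr'.trans h, fun h => hr'.symm.trans h⟩
      rw [hset]
    · refine ⟨q r, ?_, hr⟩
      simp only [Finset.image_singleton, Finset.mem_union, Finset.mem_singleton]
      exact hqport i r (Ne.symm hir)
  · -- (ii) `c` light and separated from the ports
    push Not at hport
    refine Or.inr (Or.inl ⟨fun σ => ?_, hport, hheavy⟩)
    have hfarL : ∀ e ∈ L σ, ∀ v ∈ e, ¬ (openGraph ω).Reachable c v := by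
      intro e he v hv
      obtain ⟨i, -, rfl⟩ := (hmemL σ e).1 he
      rcases Sym2.mem_iff.1 hv with rfl | rfl
      · rw [hp i]; exact hport _
      · rw [hp' i]; exact hport _
    have hiff := reachable_union_links_iff ω (L σ) c hfarL
    have hset : (A.filter fun z => (openGraph (ω ∪ L σ)).Reachable c z) = A.filter fun z => (openGraph ω).Reachable c z :=
      Finset.filter_congr fun z _ => hiff z
    rw [hset]; exact hheavy

end StarSet

end Summit.CriticalPhenomena.PercolationContinuityZ3.Theorems

end
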